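import Mathlib
import Summits.ResolutionOfSingularities.ResolutionOfSingularities.Theorems.RadicialJungCleanModelsCleanPermissibleSeqComp
import HarnessLib

/-!
# Route `RadicialJung`, crux `CleanModels` (stmt-ResolutionOfSingularities-15917), line `Sketch` rev 18, stub 4e
# `stub_cleanPrincipalization3`: cleanness propagates along clean-permissible sequences for an idealistic exponent

API for the future prover of the research residue X44c of 4e (memo `Cruxes/CleanModels/Lines/Sketch-memo-4e-cleanPermissible.md`): inside a
proof of X44c one builds an `IsCleanPermissibleSeq` (✓ p684619) step by step and must know, at every intermediate stage, that the line is still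
clean-regular EVERYWHERE (to read off the clean structure and to certify the next centre, e.g. by ✓ `cleanPermissible_of_cleanRegAt` /
✓ `cleanPermissibleAt_of_split`).  This is the idealistic-exponent twin of ✓ `IsCleanRegularCentreBlowupSeq.cleanRegAt`.

* `IsCleanPermissibleSeq.single` — one clean-permissible blowing up is a clean-permissible sequence;
* `IsCleanPermissibleSeq.cleanRegAt` — **cleanness propagates**: clean-regular at every point of `X` ⇒ clean-regular at every point of `X'`
  for `π^♯ G` (induction over ✓ `cleanRegAt_of_isBlowup_step`).

Honest framing: OURS, plumbing; nothing here proves resolution in characteristic `p` or any case of `CleanModels`.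
-/

noncomputable section

set_option linter.dupNamespace false -- mandated namespace of this single-conjunct summit

open IsLocalRing CategoryTheory AlgebraicGeometry TopologicalSpace
open Literature.AlgebraicGeometry.Resolution Literature.AlgebraicGeometry.Motives
open Scheme.IdealSheafData

namespace Summit.ResolutionOfSingularities.ResolutionOfSingularities.Theorems.RadicialJung.CleanModels

namespace IsCleanPermissibleSeq

variable {p : ℕ}

/-- A single clean-permissible blowing up along a regular integral centre inside `{ord = μ}` is a clean-permissible sequence. [folklore] -/
theorem single {X' X : Scheme.{0}} [IsIntegral X'] [IsIntegral X] (τ : X' ⟶ X) [IsDominant τ] (J : X.IdealSheafData) (μ : ℕ)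
    (G : X.functionField) (Y : Closeds X) (hint : IsIntegral (vanishingIdeal Y).subscheme)
    (hreg : Scheme.IsRegular (vanishingIdeal Y).subscheme) (hY : ∀ y ∈ (Y : Set X), idealOrder J y = μ)
    (hτ : IsBlowup τ (vanishingIdeal Y))
    (hperm : ∀ y ∈ (Y : Set X), CleanPermissibleAt p (algebraMap (X.presheaf.stalk y) X.functionField)
      (RatFn.functionFieldMap (𝟙 X) G) (stalkIdeal (vanishingIdeal Y) y)) :
    IsCleanPermissibleSeq p τ J μ (controlledTransform τ (vanishingIdeal Y) J μ) G := by
  have h := IsCleanPermissibleSeq.cons τ (𝟙 X) J μ J G Y (IsCleanPermissibleSeq.nil J μ G) hint hreg hY hτ hperm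
  exact IsCleanPermissibleSeq.of_eq (Category.comp_id τ) h

/-- **Cleanness propagates along a clean-permissible sequence**: if the line of `G` is clean-regular at every point of `X` (function field of
characteristic `p`), then the line of `π^♯ G` is clean-regular at every point of `X'` — each step is ✓ `cleanRegAt_of_isBlowup_step` applied to
the blowing up along `𝓘_Y` (over `Y`: the centre is clean-permissible by hypothesis; off `Y`: local isomorphism).
[cite: Piltant2013, §2 Axioms 2 (ii) and 4] -/
theorem cleanRegAt (hp : p.Prime) {X' X : Scheme.{0}} [IsIntegral X'] [IsIntegral X] {π : X' ⟶ X} [IsDominant π]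
    {J : X.IdealSheafData} {μ : ℕ} {J' : X'.IdealSheafData} {G : X.functionField} (h : IsCleanPermissibleSeq p π J μ J' G) :
    CharP X.functionField p → (∀ x : X, CleanRegAt p (algebraMap (X.presheaf.stalk x) X.functionField) G) →
      ∀ x' : X', CleanRegAt p (algebraMap (X'.presheaf.stalk x') X'.functionField) (RatFn.functionFieldMap π G) := by
  induction h with
  | nil J μ G =>
    intro _ hG x
    rw [RatFn.functionFieldMap_id]
    exact hG x
  | @cons X'' X' X _ _ _ τ _ π _ J μ J' G Y hπ hint hreg hY hτ hperm ih =>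
    intro hchar hG x''
    have hchar' : CharP X'.functionField p := charP_of_injective_ringHom (RatFn.functionFieldMap π).injective p
    have key : CleanRegAt p (algebraMap (X''.presheaf.stalk x'') X''.functionField)
        (RatFn.functionFieldMap τ (RatFn.functionFieldMap π G)) :=
      cleanRegAt_of_isBlowup_step (S := X') p hp hchar' (RatFn.functionFieldMap π G) (ih hchar hG) (vanishingIdeal Y)
        (fun s hs => hperm s (by rwa [← SetLike.mem_coe, coe_support_vanishingIdeal] at hs)) τ hτ x''
    rw [RatFn.functionFieldMap_comp, RingHom.comp_apply]
    exact key

end IsCleanPermissibleSeq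

end Summit.ResolutionOfSingularities.ResolutionOfSingularities.Theorems.RadicialJung.CleanModels

end
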